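import Mathlib
import Literature.NumberTheory.Transcendental.DrinfeldAssociatorTransport
import Literature.NumberTheory.Transcendental.MZVWordShuffleProofs
import Literature.NumberTheory.Transcendental.MZVShuffleRegularisation
import Literature.NumberTheory.Transcendental.MultipleZetaHoffmanRelationGeneralProofs
import HarnessLib

/-!
# The KZ equation on `(0,1)`: regularised iterated integrals, their limits with rates, and `ζ(V)`

Third proofs file towards `drinfeldAssociator_pentagon` (`DrinfeldAssociator.lean`,
[Drinfeld1991, (2.13)]): the real analysis of the transport of `G'(t) = (A/t + B/(t-1)) G(t)`
[Furusho2003, §3.1] over `[ε, b] ⊆ (0,1)` as `ε → 0`, `b → 1`, in the coefficientwise language of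
`DrinfeldAssociatorTransport.lean` (`iterInt`, `transportSeries`). Everything is proved; no named
fact is introduced. With the POSITIVE densities `P = KZ.mzvForm` (`P false = 1/t`,
`P true = 1/(1-t)`; the KZ densities are `F₀ false = P false`, `F₀ true = -P true`, so that
`I^{F₀}_w = (-1)^{#B(w)} I^{P}_w`, `KZ3.iterInt_F₀`) all iterated integrals are nonnegative and
monotone in the domain, and:

1. **Bounds** (`§3`): the crude bound `I_w(a,b) ≤ (|log a| + |log(1-b)|)^{|w|}` and the two
   refined ones from `DrinfeldAssociatorTransport.lean`: a nonempty word ending with `B = true`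
   (regular at `0`) has `I_w(a,x) ≤ (2/(1-x))^{|w|} x`, one starting with `A = false` has
   `I_w(x,b) ≤ (2/x)^{|w|} (1-x)`.
2. **The bottom limit** (`§4`) `L_w(b) = lim_{ε→0⁺} I_w(ε,b)` for words ending with `B` (a
   supremum, `KZ3.botLim`), with the RATE `0 ≤ L_w(b) - I_w(ε,b) ≤ (|w|+1)(|log ε|+|log(1-b)|+1)^{|w|}
   4^{|w|} ε` (`KZ3.botLim_sub_le`: Chen's identity at `ε` and the refined bound on `[ε', ε]`);
   symmetrically **the top limit** (`§5`) `U_u = lim_{b→1⁻} I_u(1/2,b)` for words starting with `A`.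
3. **Convergent words** (`§6`, `A ⋯ B` or empty): `Z(V) := Σ_{V=V₁V₂} U_{V₁} L_{V₂}(1/2)` satisfies
   `|I_V(ε,b) - Z(V)| ≤ (|V|+1)² 16^{|V|} ρ_{|V|}(ε,b)`,
   `ρ_n(ε,b) = (|log ε|+2)ⁿ ε + (|log(1-b)|+2)ⁿ (1-b)` (`KZ3.abs_iterInt_sub_Z_le`).
4. **The bridge to the tree** (`§7–8`): by monotone convergence and induction on the word through
   the slicing `KZ.MZVSimplex.wordLIntegral_cons`, `L_w(b)` IS the tree's simplex integral
   `Λ_w(b) = ∫⁻_{b>t₁>⋯>t_n>0} ∏ ω` (`KZ3.ofReal_botLim_eq_Λ`), whence, by continuity of `Λ_V` in the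
   upper bound and Kontsevich's formula `KZ.wordLIntegral_one_eq_ofReal_multipleZeta`,
   **`Z(V) = ζ(V) = multipleZeta (ofBinaryWord V)`** (`KZ3.Z_eq_multipleZeta`) and the improper
   iterated integral converges to it with the rate above (`KZ3.abs_iterInt_sub_multipleZeta_le`).
   This is the analytic content of "`Z(W)` = the iterated integral from `0` to `1` obtained by
   replacing `A` by `du/u` and `B` by `du/(1-u)`" [Furusho2003, §3.2] for the tree's `multipleZeta`.
5. `§9`: the KZ transport series `KZ3.kzTransport a b` (group-like; `T̂_A = log(b/a)`,
   `T̂_B = log((1-b)/(1-a))`), the input of the factorisation of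
   `DrinfeldAssociatorRegularisation.lean`.

## References

* H. Furusho, Publ. RIMS 39 (2003), §3.1–3.2 (arXiv:math/0011261 pp. 9–10). [Furusho2003]
* V. G. Drinfel'd, Leningrad Math. J. 2 (1991), 829–860, §2. [Drinfeld1991]
* M. Kontsevich, D. Zagier, *Periods* (2001), §1.1 (iterated integral for `ζ`). [KontsevichZagier2001]
-/

noncomputable section

open MeasureTheory intervalIntegral Set Filter
open scoped BigOperators Topology ENNReal

namespace Literature.NumberTheory.Transcendental

namespace KZ3


/-! ## 1. The two positive KZ densities `ω₀ = dt/t`, `ω₁ = dt/(1-t)` on `(0,1)` -/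

/-- The letter densities of the KZ equation on `(0,1)` in the POSITIVE normalisation of the tree's
`KZ.mzvForm`: `P false t = 1/t` (`A = X₀ = du/u`), `P true t = 1/(1-t)` (`-B`, `X₁ ↔ du/(u-1)`).
[cite: Furusho2003, §3.1–3.2] -/
abbrev P : Bool → ℝ → ℝ := KZ.mzvForm

/-- `P false t = 1/t`. [folklore] -/
theorem P_false (t : ℝ) : P false t = 1 / t := rfl

/-- `P true t = 1/(1-t)`. [folklore] -/
theorem P_true (t : ℝ) : P true t = 1 / (1 - t) := rfl

/-- The densities are continuous on `(0,1)`. [folklore] -/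
theorem continuousOn_P (c : Bool) : ContinuousOn (P c) (Ioo 0 1) := by
  cases c
  · exact continuousOn_const.div continuousOn_id fun t ht => ht.1.ne'
  · exact continuousOn_const.div (continuousOn_const.sub continuousOn_id)
      fun t ht => sub_ne_zero.mpr (ne_of_gt ht.2)

/-- The densities are nonnegative on `(0,1)`. [folklore] -/
theorem P_nonneg (c : Bool) (t : ℝ) (ht : t ∈ Ioo (0 : ℝ) 1) : 0 ≤ P c t := by
  cases c
  · rw [P_false]; exact div_nonneg zero_le_one ht.1.le
  · rw [P_true]; exact div_nonneg zero_le_one (by linarith [ht.2])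

/-- `(0,1)` is open. [folklore] -/
theorem isOpen_Ioo01 : IsOpen (Ioo (0 : ℝ) 1) := isOpen_Ioo

/-- `(0,1)` is an interval. [folklore] -/
theorem ordConnected_Ioo01 : (Ioo (0 : ℝ) 1).OrdConnected := ordConnected_Ioo

/-! ## 2. The tree's simplex integrals `Λ_W(x)` and their nesting -/

/-- The tree's iterated integral `Λ_W(x) = ∫⁻_{x > t₁ > ⋯ > t_n > 0} ∏ ω_{Wᵢ}(tᵢ)` in `ℝ≥0∞` (the
two sides of `KZ.MZVSimplex.wordLIntegral_cons`), as a function of the word. [cite: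
KontsevichZagier2001, §1.1] -/
def Λ (W : List Bool) (x : ℝ) : ℝ≥0∞ :=
  ∫⁻ t in {t : Fin W.length → ℝ | (∀ i, 0 < t i) ∧ (∀ i, t i < x) ∧ StrictAnti t},
    ∏ i : Fin W.length, ENNReal.ofReal (KZ.mzvForm (W.getD i false) (t i))

/-- `Λ_∅(x) = 1`. [folklore] -/
theorem Λ_nil (x : ℝ) : Λ [] x = 1 := KZ.MZVSimplex.wordLIntegral_zero [] x

/-- Slicing: `Λ_{eW}(x) = ∫⁻_{(0,x)} ω_e Λ_W` (`KZ.MZVSimplex.wordLIntegral_cons`). [folklore] -/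
theorem Λ_cons (e : Bool) (W : List Bool) (x : ℝ) :
    Λ (e :: W) x = ∫⁻ t₀ in Ioo 0 x, ENNReal.ofReal (P e t₀) * Λ W t₀ :=
  KZ.MZVSimplex.wordLIntegral_cons e W W.length x

/-- Kontsevich's formula in the tree: `Λ_V(1) = ζ(V)` for a convergent word
(`KZ.wordLIntegral_one_eq_ofReal_multipleZeta`). [cite: KontsevichZagier2001, §1.1] -/
theorem Λ_one_eq {V : List Bool} (hh : V.head? ≠ some true) (hl : V = [] ∨ V.getLast? = some true) :
    Λ V 1 = ENNReal.ofReal (multipleZeta (MZV.ofBinaryWord V)) :=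
  KZ.wordLIntegral_one_eq_ofReal_multipleZeta hh hl

/-! ## 3. Crude `L¹` bounds and the two families of one-sided iterated integrals -/

section Bounds

/-- `∫_a^b dt/t ≤ |log a|` for `0 < a ≤ b ≤ 1`. [folklore] -/
theorem integral_abs_P_false_le {a b : ℝ} (ha : 0 < a) (hab : a ≤ b) (hb : b ≤ 1) :
    ∫ t in a..b, |P false t| ≤ |Real.log a| := by
  have h : ∫ t in a..b, |P false t| = ∫ t in a..b, t⁻¹ := by
    refine integral_congr fun t ht => ?_
    rw [uIcc_of_le hab] at ht
    rw [P_false, one_div, abs_of_pos (inv_pos.mpr (ha.trans_le ht.1))]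
  rw [h, integral_inv_of_pos ha (ha.trans_le hab), abs_of_nonpos (Real.log_nonpos ha.le
    (hab.trans hb))]
  have : Real.log b ≤ 0 := Real.log_nonpos (ha.le.trans hab) hb
  have := Real.log_le_log ha hab
  rw [Real.log_div (ha.trans_le hab).ne' ha.ne']
  linarith

/-- `∫_a^b dt/(1-t) ≤ |log(1-b)|` for `0 ≤ a ≤ b < 1`. [folklore] -/
theorem integral_abs_P_true_le {a b : ℝ} (ha : 0 ≤ a) (hab : a ≤ b) (hb : b < 1) :
    ∫ t in a..b, |P true t| ≤ |Real.log (1 - b)| := by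
  have h : ∫ t in a..b, |P true t| = ∫ t in a..b, (1 - t)⁻¹ := by
    refine integral_congr fun t ht => ?_
    rw [uIcc_of_le hab] at ht
    rw [P_true, one_div, abs_of_pos (inv_pos.mpr (by linarith [ht.2]))]
  rw [h, intervalIntegral.integral_comp_sub_left (fun t => t⁻¹) 1,
    integral_inv_of_pos (by linarith) (by linarith),
    abs_of_nonpos (Real.log_nonpos (by linarith) (by linarith))]
  have h1 : Real.log (1 - a) ≤ 0 := Real.log_nonpos (by linarith) (by linarith)
  rw [Real.log_div (by linarith) (by linarith)]
  linarith

/-- The crude bound `I_w(a,b) ≤ (|log a| + |log(1-b)|)^{|w|}` on `[a,b] ⊆ (0,1)`. [folklore] -/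
theorem iterInt_P_le_pow (w : List Bool) {a b : ℝ} (ha : 0 < a) (hab : a ≤ b) (hb : b < 1) :
    iterInt P w a b ≤ (|Real.log a| + |Real.log (1 - b)|) ^ w.length := by
  have ha' : a ∈ Ioo (0 : ℝ) 1 := ⟨ha, hab.trans_lt hb⟩
  have hb' : b ∈ Ioo (0 : ℝ) 1 := ⟨ha.trans_le hab, hb⟩
  refine (le_abs_self _).trans ((abs_iterInt_le_prod isOpen_Ioo01 ordConnected_Ioo01
    continuousOn_P ha' w hb' hab).trans ?_)
  have : ∀ c ∈ w, (∫ t in a..b, |P c t|) ≤ |Real.log a| + |Real.log (1 - b)| := by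
    intro c _
    cases c
    · exact (integral_abs_P_false_le ha hab hb.le).trans (le_add_of_nonneg_right (abs_nonneg _))
    · exact (integral_abs_P_true_le ha.le hab hb).trans (le_add_of_nonneg_left (abs_nonneg _))
  calc (w.map fun c => ∫ t in a..b, |P c t|).prod
      ≤ (w.map fun _ => |Real.log a| + |Real.log (1 - b)|).prod :=
        list_prod_map_le_prod_map w (fun c _ => intervalIntegral.integral_nonneg hab
          fun t _ => abs_nonneg _) this
    _ = (|Real.log a| + |Real.log (1 - b)|) ^ w.length := by
        rw [List.map_const', List.prod_replicate]

/-- Nonnegativity of the iterated integrals of the positive densities. [folklore] -/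
theorem iterInt_P_nonneg (w : List Bool) {a b : ℝ} (ha : 0 < a) (hab : a ≤ b) (hb : b < 1) :
    0 ≤ iterInt P w a b :=
  iterInt_nonneg ordConnected_Ioo01 (fun c t ht => P_nonneg c t ht) ⟨ha, hab.trans_lt hb⟩ w
    ⟨ha.trans_le hab, hb⟩ hab

/-- **Bottom smallness**: on `[a,x] ⊆ (0,1)` a nonempty word ending with `true` (`dt/(1-t)`, bounded
by `2/(1-x)` on `(0,(1+x)/2)`) has `I_w(a,x) ≤ (2/(1-x))^{|w|} x`. [folklore] -/
theorem iterInt_P_le_of_getLast {w : List Bool} (hw : w ≠ []) (hl : w.getLast hw = true) {a x : ℝ}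
    (ha : 0 < a) (hax : a ≤ x) (hx : x < 1) : iterInt P w a x ≤ (2 / (1 - x)) ^ w.length * x := by
  set X := (1 + x) / 2 with hX
  have hxX : x < X := by rw [hX]; linarith
  have hX1 : X < 1 := by rw [hX]; linarith
  have hM : (1 : ℝ) ≤ 2 / (1 - x) := by rw [le_div_iff₀ (by linarith)]; linarith [ha.trans_le hax]
  have hs' : IsOpen (Ioo (0 : ℝ) X) := isOpen_Ioo
  have hso' : (Ioo (0 : ℝ) X).OrdConnected := ordConnected_Ioo
  have hf' : ∀ c, ContinuousOn (P c) (Ioo (0 : ℝ) X) := fun c =>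
    (continuousOn_P c).mono (Ioo_subset_Ioo_right hX1.le)
  have h := abs_iterInt_le_of_last_bdd hs' hso' hf' (fun c => c = true) (K := 1) (M := 2 / (1 - x))
    zero_le_one (by positivity) ⟨ha, hax.trans_lt hxX⟩ ha ?_ ?_ w hw (by simpa using hl) (x := x)
    ⟨ha.trans_le hax, hxX⟩ hax
  · refine (le_abs_self _).trans (h.trans ?_)
    have hq : countBdd (fun c => c = true) w ≤ w.length := List.length_filter_le _ _
    have hq1 : 1 ≤ countBdd (fun c => c = true) w := by
      have : w.getLast hw ∈ w.filter fun c => c = true :=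
        List.mem_filter.mpr ⟨List.getLast_mem hw, by simpa using hl⟩
      exact List.length_pos_iff.mpr (List.ne_nil_of_mem this)
    have hx0 : 0 ≤ x := ha.le.trans hax
    rw [one_pow, one_mul]
    calc (2 / (1 - x)) ^ countBdd (fun c => c = true) w * x ^ countBdd (fun c => c = true) w
        ≤ (2 / (1 - x)) ^ w.length * x ^ 1 :=
          mul_le_mul (pow_le_pow_right₀ hM hq) (pow_le_pow_of_le_one hx0 hx.le hq1)
            (by positivity) (by positivity)
      _ = (2 / (1 - x)) ^ w.length * x := by rw [pow_one]
  · intro c hc t ht _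
    subst hc
    have h1t : 0 < 1 - t := by rw [hX] at ht; linarith [ht.2]
    rw [P_true, abs_of_pos (div_pos one_pos h1t), div_le_div_iff₀ h1t (by linarith)]
    rw [hX] at ht
    linarith [ht.2]
  · intro c hc t ht _
    have hc' : c = false := by simpa using hc
    subst hc'
    rw [P_false, abs_of_pos (by have := ht.1; positivity)]

/-- **Top smallness**: on `[x,b] ⊆ (0,1)` a nonempty word starting with `false` (`dt/t`, bounded by
`2/x` on `(x/2,1)`) has `I_w(x,b) ≤ (2/x)^{|w|} (1-x)`. [folklore] -/
theorem iterInt_P_le_of_head {w : List Bool} (hw : w ≠ []) (hh : w.head hw = false) {x b : ℝ}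
    (hx : 0 < x) (hxb : x ≤ b) (hb : b < 1) : iterInt P w x b ≤ (2 / x) ^ w.length * (1 - x) := by
  have hM : (1 : ℝ) ≤ 2 / x := by rw [le_div_iff₀ hx]; linarith [hxb.trans_lt hb]
  have hs' : IsOpen (Ioo (x / 2) 1) := isOpen_Ioo
  have hso' : (Ioo (x / 2) 1).OrdConnected := ordConnected_Ioo
  have hf' : ∀ c, ContinuousOn (P c) (Ioo (x / 2) 1) := fun c =>
    (continuousOn_P c).mono (Ioo_subset_Ioo_left (by linarith))
  have h := abs_iterInt_le_of_head_bdd hs' hso' hf' (fun c => c = false) (K := 1) (M := 2 / x)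
    zero_le_one (by positivity) ⟨by linarith, hb⟩ hb ?_ ?_ w hw (by simpa using hh) (x := x)
    ⟨by linarith, hxb.trans_lt hb⟩ hxb
  · refine (le_abs_self _).trans (h.trans ?_)
    have hq : countBdd (fun c => c = false) w ≤ w.length := List.length_filter_le _ _
    have hq1 : 1 ≤ countBdd (fun c => c = false) w := by
      have : w.head hw ∈ w.filter fun c => c = false :=
        List.mem_filter.mpr ⟨List.head_mem hw, by simpa using hh⟩
      exact List.length_pos_iff.mpr (List.ne_nil_of_mem this)
    have hx0 : 0 ≤ 1 - x := by linarith
    have hx1 : 1 - x ≤ 1 := by linarith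
    rw [one_pow, one_mul]
    calc (2 / x) ^ countBdd (fun c => c = false) w * (1 - x) ^ countBdd (fun c => c = false) w
        ≤ (2 / x) ^ w.length * (1 - x) ^ 1 :=
          mul_le_mul (pow_le_pow_right₀ hM hq) (pow_le_pow_of_le_one hx0 hx1 hq1)
            (by positivity) (by positivity)
      _ = (2 / x) ^ w.length * (1 - x) := by rw [pow_one]
  · intro c hc t ht _
    subst hc
    have ht0 : 0 < t := by linarith [ht.1]
    rw [P_false, abs_of_pos (div_pos one_pos ht0), div_le_div_iff₀ ht0 hx]
    linarith [ht.1]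
  · intro c hc t ht _
    have hc' : c = true := by simpa using hc
    subst hc'
    rw [P_true, abs_of_pos (by have := ht.2; exact div_pos one_pos (by linarith))]

end Bounds

/-! ## 4. The bottom family `ε ↦ I_w(ε, b)` and its limit `ε → 0⁺` -/

section Bot

/-- Words that are empty or end with the letter `true` (= `dt/(1-t)`, regular at `0`). [folklore] -/
def IsBotWord (w : List Bool) : Prop := w = [] ∨ w.getLast? = some true

/-- A nonempty bottom word ends with `true`. [folklore] -/
theorem IsBotWord.getLast_eq {w : List Bool} (h : IsBotWord w) (hw : w ≠ []) : w.getLast hw = true := by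
  rcases h with h | h
  · exact absurd h hw
  · rw [List.getLast?_eq_some_getLast hw] at h
    exact Option.some.inj h

/-- Suffixes of bottom words are bottom words. [folklore] -/
theorem IsBotWord.suffix {v : List Bool} (u w : List Bool) (h : IsBotWord v) (huw : u ++ w = v) :
    IsBotWord w := by
  by_cases hw : w = []
  · exact Or.inl hw
  · right
    rcases h with h | h
    · rw [← huw] at h; simp [hw] at h
    · rw [← huw, List.getLast?_append_of_ne_nil _ hw] at h
      exact h

/-- Uniform bound `I_w(ε,b) ≤ (2/(1-b))^{|w|}` for a bottom word. [folklore] -/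
theorem iterInt_P_le_of_isBotWord {w : List Bool} (hw : IsBotWord w) {ε b : ℝ} (hε : 0 < ε)
    (hεb : ε ≤ b) (hb : b < 1) : iterInt P w ε b ≤ (2 / (1 - b)) ^ w.length := by
  by_cases hne : w = []
  · subst hne; simp
  · refine (iterInt_P_le_of_getLast hne (hw.getLast_eq hne) hε hεb hb).trans ?_
    have hM : (0 : ℝ) ≤ (2 / (1 - b)) ^ w.length := by
      have : 0 < 1 - b := by linarith
      positivity
    calc (2 / (1 - b)) ^ w.length * b ≤ (2 / (1 - b)) ^ w.length * 1 :=
          mul_le_mul_of_nonneg_left hb.le hM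
      _ = _ := mul_one _

/-- The bottom family is antitone in the lower limit. [folklore] -/
theorem antitoneOn_iterInt_P (w : List Bool) {b : ℝ} (hb : b ∈ Ioo (0 : ℝ) 1) :
    AntitoneOn (fun ε => iterInt P w ε b) (Ioo 0 b) := by
  intro ε' hε' ε hε hle
  exact iterInt_anti_left isOpen_Ioo01 ordConnected_Ioo01 continuousOn_P (fun c t ht => P_nonneg c t ht)
    ⟨hε'.1, hε'.2.trans hb.2⟩ ⟨hε.1, hε.2.trans hb.2⟩ hb hle hε.2.le w

/-- **The regularised value at `0`**: `L_w(b) = lim_{ε→0⁺} I_w(ε,b) = sup_ε I_w(ε,b)` for a bottom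
word and `b ∈ (0,1)` (the coefficient of `w` in `lim_ε G_ε(b) ε^{A}`… restricted to words not ending
with `A`). [cite: Furusho2003, §3.1 (G₀)] -/
def botLim (w : List Bool) (b : ℝ) : ℝ := sSup ((fun ε => iterInt P w ε b) '' Ioo 0 b)

/-- The bottom family is bounded above. [folklore] -/
theorem bddAbove_bot {w : List Bool} (hw : IsBotWord w) {b : ℝ} (hb : b ∈ Ioo (0 : ℝ) 1) :
    BddAbove ((fun ε => iterInt P w ε b) '' Ioo 0 b) := by
  refine ⟨(2 / (1 - b)) ^ w.length, ?_⟩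
  rintro _ ⟨ε, hε, rfl⟩
  exact iterInt_P_le_of_isBotWord hw hε.1 hε.2.le hb.2

/-- `I_w(ε,b) → L_w(b)` as `ε → 0⁺`. [folklore] -/
theorem tendsto_botLim {w : List Bool} (hw : IsBotWord w) {b : ℝ} (hb : b ∈ Ioo (0 : ℝ) 1) :
    Tendsto (fun ε => iterInt P w ε b) (𝓝[>] 0) (𝓝 (botLim w b)) :=
  (antitoneOn_iterInt_P w hb).tendsto_nhdsWithin_Ioo_right (nonempty_Ioo.mpr hb.1) (bddAbove_bot hw hb)

/-- `I_w(ε,b) ≤ L_w(b)`. [folklore] -/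
theorem iterInt_le_botLim {w : List Bool} (hw : IsBotWord w) {ε b : ℝ} (hb : b ∈ Ioo (0 : ℝ) 1)
    (hε : ε ∈ Ioo 0 b) : iterInt P w ε b ≤ botLim w b :=
  le_csSup (bddAbove_bot hw hb) ⟨ε, hε, rfl⟩

/-- `L_w(b) ≤ (2/(1-b))^{|w|}`. [folklore] -/
theorem botLim_le {w : List Bool} (hw : IsBotWord w) {b : ℝ} (hb : b ∈ Ioo (0 : ℝ) 1) :
    botLim w b ≤ (2 / (1 - b)) ^ w.length :=
  csSup_le ((nonempty_Ioo.mpr hb.1).image _) (by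
    rintro _ ⟨ε, hε, rfl⟩; exact iterInt_P_le_of_isBotWord hw hε.1 hε.2.le hb.2)

/-- `0 ≤ L_w(b)`. [folklore] -/
theorem botLim_nonneg {w : List Bool} (hw : IsBotWord w) {b : ℝ} (hb : b ∈ Ioo (0 : ℝ) 1) :
    0 ≤ botLim w b := by
  have hε : b / 2 ∈ Ioo 0 b := ⟨by linarith [hb.1], by linarith [hb.1]⟩
  exact (iterInt_P_nonneg w hε.1 hε.2.le hb.2).trans (iterInt_le_botLim hw hb hε)

/-- `L_∅(b) = 1`. [folklore] -/
@[simp] theorem botLim_nil {b : ℝ} (hb : b ∈ Ioo (0 : ℝ) 1) : botLim [] b = 1 := by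
  refine tendsto_nhds_unique (tendsto_botLim (Or.inl rfl) hb) ?_
  simp

/-- **Rate at the bottom**: `I_w(ε',b) - I_w(ε,b) ≤ (|w|+1)(|log ε|+|log(1-b)|+1)^{|w|} 4^{|w|} ε`
for `0 < ε' ≤ ε ≤ min(1/2, b)` (Chen at `ε` and bottom smallness). [folklore] -/
theorem iterInt_P_sub_le {w : List Bool} (hw : IsBotWord w) {ε' ε b : ℝ} (hε' : 0 < ε')
    (hle : ε' ≤ ε) (hε : ε ≤ 1 / 2) (hεb : ε ≤ b) (hb : b < 1) :
    iterInt P w ε' b - iterInt P w ε b ≤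
      (w.length + 1) * ((|Real.log ε| + |Real.log (1 - b)| + 1) ^ w.length * 4 ^ w.length * ε) := by
  classical
  have hε0 : 0 < ε := hε'.trans_le hle
  have hε1 : ε < 1 := by linarith
  have hb' : b ∈ Ioo (0 : ℝ) 1 := ⟨hε0.trans_le hεb, hb⟩
  rw [iterInt_chen isOpen_Ioo01 ordConnected_Ioo01 continuousOn_P (a := ε') (b := ε) ⟨hε', by linarith⟩
    ⟨hε0, hε1⟩ w hb', ← Finset.add_sum_erase _ _ (NCSeries.self_nil_mem_splits w), iterInt_nil, mul_one,
    add_sub_cancel_left]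
  have hcard : ((NCSeries.splits w).erase (w, [])).card ≤ w.length + 1 := by
    refine (Finset.card_erase_le).trans ?_
    rw [NCSeries.splits, Finset.card_map]; simp
  refine (Finset.sum_le_card_nsmul _ _
    ((|Real.log ε| + |Real.log (1 - b)| + 1) ^ w.length * 4 ^ w.length * ε) ?_).trans ?_
  · intro p hp
    obtain ⟨hne, hp⟩ := Finset.mem_erase.mp hp
    rw [NCSeries.mem_splits] at hp
    have hp2 : p.2 ≠ [] := by
      intro h2; apply hne; ext1
      · simpa [h2] using hp
      · exact h2
    have hbw2 : IsBotWord p.2 := hw.suffix p.1 p.2 hp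
    have hl2 : p.2.getLast hp2 = true := hbw2.getLast_eq hp2
    have hlen1 : p.1.length ≤ w.length := by
      have := congrArg List.length hp; simp at this; omega
    have hlen2 : p.2.length ≤ w.length := by
      have := congrArg List.length hp; simp at this; omega
    have h1 : iterInt P p.1 ε b ≤ (|Real.log ε| + |Real.log (1 - b)| + 1) ^ w.length :=
      ((iterInt_P_le_pow p.1 hε0 hεb hb).trans (pow_le_pow_left₀ (by positivity) (by linarith) _)).trans
        (pow_le_pow_right₀ (by linarith [abs_nonneg (Real.log ε), abs_nonneg (Real.log (1 - b))]) hlen1)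
    have h2 : iterInt P p.2 ε' ε ≤ 4 ^ w.length * ε := by
      refine (iterInt_P_le_of_getLast hp2 hl2 hε' hle hε1).trans ?_
      refine mul_le_mul_of_nonneg_right ?_ hε0.le
      calc (2 / (1 - ε)) ^ p.2.length ≤ 4 ^ p.2.length := by
            refine pow_le_pow_left₀ (by positivity) ?_ _
            rw [div_le_iff₀ (by linarith)]; linarith
        _ ≤ 4 ^ w.length := pow_le_pow_right₀ (by norm_num) hlen2
    calc iterInt P p.1 ε b * iterInt P p.2 ε' ε
        ≤ (|Real.log ε| + |Real.log (1 - b)| + 1) ^ w.length * (4 ^ w.length * ε) :=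
          mul_le_mul h1 h2 (iterInt_P_nonneg _ hε' hle hε1) (by positivity)
      _ = _ := by ring
  · rw [nsmul_eq_mul]
    refine mul_le_mul_of_nonneg_right ?_ (by positivity)
    exact_mod_cast hcard

/-- **The bottom limit with rate**: `0 ≤ L_w(b) - I_w(ε,b) ≤ (|w|+1)(|log ε|+|log(1-b)|+1)^{|w|}
4^{|w|} ε`. [folklore] -/
theorem botLim_sub_le {w : List Bool} (hw : IsBotWord w) {ε b : ℝ} (hε0 : 0 < ε) (hε : ε ≤ 1 / 2)
    (hεb : ε < b) (hb : b < 1) :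
    botLim w b - iterInt P w ε b ≤
      (w.length + 1) * ((|Real.log ε| + |Real.log (1 - b)| + 1) ^ w.length * 4 ^ w.length * ε) := by
  have hb' : b ∈ Ioo (0 : ℝ) 1 := ⟨hε0.trans hεb, hb⟩
  have ht : Tendsto (fun ε' => iterInt P w ε' b - iterInt P w ε b) (𝓝[>] 0)
      (𝓝 (botLim w b - iterInt P w ε b)) := (tendsto_botLim hw hb').sub_const _
  refine le_of_tendsto ht ?_
  filter_upwards [Ioo_mem_nhdsGT hε0] with ε' hε'
  exact iterInt_P_sub_le hw hε'.1 hε'.2.le hε hεb.le hb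

end Bot

/-! ## 5. The top family `b ↦ I_u(1/2, b)` and its limit `b → 1⁻` -/

section Top

/-- Words that are empty or start with the letter `false` (= `dt/t`, regular at `1`). [folklore] -/
def IsTopWord (u : List Bool) : Prop := u = [] ∨ u.head? = some false

/-- A nonempty top word starts with `false`. [folklore] -/
theorem IsTopWord.head_eq {u : List Bool} (h : IsTopWord u) (hu : u ≠ []) : u.head hu = false := by
  rcases h with h | h
  · exact absurd h hu
  · rw [List.head?_eq_some_head hu] at h
    exact Option.some.inj h

/-- Prefixes of top words are top words. [folklore] -/
theorem IsTopWord.prefix {v : List Bool} (u w : List Bool) (h : IsTopWord v) (huw : u ++ w = v) :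
    IsTopWord u := by
  by_cases hu : u = []
  · exact Or.inl hu
  · right
    rcases h with h | h
    · rw [← huw] at h; simp [hu] at h
    · rw [← huw, List.head?_append_of_ne_nil _ hu] at h
      exact h

/-- Uniform bound `I_u(1/2,b) ≤ 4^{|u|}` for a top word. [folklore] -/
theorem iterInt_P_half_le_of_isTopWord {u : List Bool} (hu : IsTopWord u) {b : ℝ}
    (hb1 : 1 / 2 ≤ b) (hb : b < 1) : iterInt P u (1 / 2) b ≤ 4 ^ u.length := by
  by_cases hne : u = []
  · subst hne; simp
  · refine (iterInt_P_le_of_head hne (hu.head_eq hne) (by norm_num) hb1 hb).trans ?_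
    norm_num

/-- The top family is monotone in the upper limit. [folklore] -/
theorem monotoneOn_iterInt_P_half (u : List Bool) :
    MonotoneOn (fun b => iterInt P u (1 / 2) b) (Ioo (1 / 2) 1) := by
  intro b hb b' hb' hle
  exact iterInt_mono_right isOpen_Ioo01 ordConnected_Ioo01 continuousOn_P (fun c t ht => P_nonneg c t ht)
    ⟨by norm_num, by norm_num⟩ ⟨by linarith [hb.1], hb.2⟩ ⟨by linarith [hb'.1], hb'.2⟩ hb.1.le hle u

/-- **The regularised value at `1`**: `U_u = lim_{b→1⁻} I_u(1/2,b)` for a top word. [cite: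
Furusho2003, §3.1 (G₁)] -/
def topLim (u : List Bool) : ℝ := sSup ((fun b => iterInt P u (1 / 2) b) '' Ioo (1 / 2) 1)

/-- The top family is bounded above. [folklore] -/
theorem bddAbove_top {u : List Bool} (hu : IsTopWord u) :
    BddAbove ((fun b => iterInt P u (1 / 2) b) '' Ioo (1 / 2 : ℝ) 1) := by
  refine ⟨4 ^ u.length, ?_⟩
  rintro _ ⟨b, hb, rfl⟩
  exact iterInt_P_half_le_of_isTopWord hu hb.1.le hb.2

/-- `I_u(1/2,b) → U_u` as `b → 1⁻`. [folklore] -/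
theorem tendsto_topLim {u : List Bool} (hu : IsTopWord u) :
    Tendsto (fun b => iterInt P u (1 / 2) b) (𝓝[<] 1) (𝓝 (topLim u)) :=
  (monotoneOn_iterInt_P_half u).tendsto_nhdsWithin_Ioo_left (nonempty_Ioo.mpr (by norm_num))
    (bddAbove_top hu)

/-- `I_u(1/2,b) ≤ U_u`. [folklore] -/
theorem iterInt_le_topLim {u : List Bool} (hu : IsTopWord u) {b : ℝ} (hb : b ∈ Ioo (1 / 2 : ℝ) 1) :
    iterInt P u (1 / 2) b ≤ topLim u :=
  le_csSup (bddAbove_top hu) ⟨b, hb, rfl⟩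

/-- `U_u ≤ 4^{|u|}`. [folklore] -/
theorem topLim_le {u : List Bool} (hu : IsTopWord u) : topLim u ≤ 4 ^ u.length :=
  csSup_le ((nonempty_Ioo.mpr (by norm_num : (1 / 2 : ℝ) < 1)).image _) (by
    rintro _ ⟨b, hb, rfl⟩; exact iterInt_P_half_le_of_isTopWord hu hb.1.le hb.2)

/-- `0 ≤ U_u`. [folklore] -/
theorem topLim_nonneg {u : List Bool} (hu : IsTopWord u) : 0 ≤ topLim u :=
  (iterInt_P_nonneg u (by norm_num) (by norm_num : (1 / 2 : ℝ) ≤ 3 / 4) (by norm_num)).trans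
    (iterInt_le_topLim hu ⟨by norm_num, by norm_num⟩)

/-- `U_∅ = 1`. [folklore] -/
@[simp] theorem topLim_nil : topLim [] = 1 := by
  refine tendsto_nhds_unique (tendsto_topLim (Or.inl rfl)) ?_
  simp

/-- **Rate at the top**: `I_u(1/2,b') - I_u(1/2,b) ≤ (|u|+1) 4^{|u|} (|log(1-b)|+2)^{|u|} (1-b)`.
[folklore] -/
theorem iterInt_P_half_sub_le {u : List Bool} (hu : IsTopWord u) {b b' : ℝ} (hb1 : 1 / 2 ≤ b)
    (hle : b ≤ b') (hb' : b' < 1) :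
    iterInt P u (1 / 2) b' - iterInt P u (1 / 2) b ≤
      (u.length + 1) * (4 ^ u.length * (|Real.log (1 - b)| + 2) ^ u.length * (1 - b)) := by
  classical
  have hb : b < 1 := hle.trans_lt hb'
  have hhalf : (1 / 2 : ℝ) ∈ Ioo (0 : ℝ) 1 := ⟨by norm_num, by norm_num⟩
  rw [iterInt_chen isOpen_Ioo01 ordConnected_Ioo01 continuousOn_P (a := 1 / 2) (b := b) hhalf
    ⟨by linarith, hb⟩ u (c := b') ⟨by linarith, hb'⟩,
    ← Finset.add_sum_erase _ _ (NCSeries.nil_self_mem_splits u), iterInt_nil, one_mul,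
    add_sub_cancel_left]
  have hcard : ((NCSeries.splits u).erase ([], u)).card ≤ u.length + 1 := by
    refine (Finset.card_erase_le).trans ?_
    rw [NCSeries.splits, Finset.card_map]; simp
  refine (Finset.sum_le_card_nsmul _ _
    (4 ^ u.length * (|Real.log (1 - b)| + 2) ^ u.length * (1 - b)) ?_).trans ?_
  · intro p hp
    obtain ⟨hne, hp⟩ := Finset.mem_erase.mp hp
    rw [NCSeries.mem_splits] at hp
    have hp1 : p.1 ≠ [] := by
      intro h1; apply hne; ext1
      · exact h1
      · simpa [h1] using hp
    have htw1 : IsTopWord p.1 := hu.prefix p.1 p.2 hp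
    have hlen1 : p.1.length ≤ u.length := by
      have := congrArg List.length hp; simp at this; omega
    have hlen2 : p.2.length ≤ u.length := by
      have := congrArg List.length hp; simp at this; omega
    have h1 : iterInt P p.1 b b' ≤ 4 ^ u.length * (1 - b) := by
      refine (iterInt_P_le_of_head hp1 (htw1.head_eq hp1) (by linarith) hle hb').trans ?_
      refine mul_le_mul_of_nonneg_right ?_ (by linarith)
      calc (2 / b) ^ p.1.length ≤ 4 ^ p.1.length := by
            refine pow_le_pow_left₀ (by positivity) ?_ _
            rw [div_le_iff₀ (by linarith)]; linarith
        _ ≤ 4 ^ u.length := pow_le_pow_right₀ (by norm_num) hlen1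
    have h2 : iterInt P p.2 (1 / 2) b ≤ (|Real.log (1 - b)| + 2) ^ u.length := by
      refine ((iterInt_P_le_pow p.2 (by norm_num) hb1 hb).trans
        (pow_le_pow_left₀ (by positivity) ?_ _)).trans (pow_le_pow_right₀ (by
          linarith [abs_nonneg (Real.log (1 - b))]) hlen2)
      have : |Real.log (1 / 2 : ℝ)| ≤ 2 := by
        rw [one_div, Real.log_inv, abs_neg, abs_of_pos (Real.log_pos (by norm_num))]
        have := Real.log_two_lt_d9; linarith
      linarith
    calc iterInt P p.1 b b' * iterInt P p.2 (1 / 2) b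
        ≤ (4 ^ u.length * (1 - b)) * (|Real.log (1 - b)| + 2) ^ u.length :=
          mul_le_mul h1 h2 (iterInt_P_nonneg _ (by norm_num) hb1 hb) (by
            have : 0 ≤ 1 - b := by linarith
            positivity)
      _ = _ := by ring
  · rw [nsmul_eq_mul]
    refine mul_le_mul_of_nonneg_right ?_ (by
      have : 0 ≤ 1 - b := by linarith
      positivity)
    exact_mod_cast hcard

/-- **The top limit with rate**: `0 ≤ U_u - I_u(1/2,b) ≤ (|u|+1) 4^{|u|} (|log(1-b)|+2)^{|u|}
(1-b)`. [folklore] -/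
theorem topLim_sub_le {u : List Bool} (hu : IsTopWord u) {b : ℝ} (hb1 : 1 / 2 < b) (hb : b < 1) :
    topLim u - iterInt P u (1 / 2) b ≤
      (u.length + 1) * (4 ^ u.length * (|Real.log (1 - b)| + 2) ^ u.length * (1 - b)) := by
  have ht : Tendsto (fun b' => iterInt P u (1 / 2) b' - iterInt P u (1 / 2) b) (𝓝[<] 1)
      (𝓝 (topLim u - iterInt P u (1 / 2) b)) := (tendsto_topLim hu).sub_const _
  refine le_of_tendsto ht ?_
  filter_upwards [Ioo_mem_nhdsLT hb] with b' hb'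
  exact iterInt_P_half_sub_le hu hb1.le hb'.1.le hb'.2

end Top

/-! ## 6. Convergent words: the regularised iterated integral `Z(V) = lim I_V(ε, b)` with rate -/

section Conv

/-- CONVERGENT words: empty, or first letter `false` (`dt/t`) and last letter `true`; =
`MZV.IsConvergentWord`. [folklore] -/
def IsConvWord (V : List Bool) : Prop := IsTopWord V ∧ IsBotWord V

/-- `IsConvWord = MZV.IsConvergentWord`. [folklore] -/
theorem isConvWord_iff (V : List Bool) : IsConvWord V ↔ MZV.IsConvergentWord V := by
  unfold IsConvWord IsTopWord IsBotWord MZV.IsConvergentWord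
  constructor
  · rintro ⟨h1 | h1, h2 | h2⟩
    · exact Or.inl h1
    · exact Or.inl h1
    · exact Or.inl h2
    · exact Or.inr ⟨h1, h2⟩
  · rintro (h | ⟨h1, h2⟩)
    · exact ⟨Or.inl h, Or.inl h⟩
    · exact ⟨Or.inr h1, Or.inr h2⟩

/-- **The regularised iterated integral over `(0,1)`** of a convergent word, `Z(V) = Σ_{V=V₁V₂}
U_{V₁} L_{V₂}(1/2)` (Chen's identity at `1/2` in the limit); it is the improper integral `lim
I_V(ε,b)` and Kontsevich's `ζ(V)` (`Z_eq_multipleZeta`). [cite: Furusho2003, §3.2 (the map Z)] -/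
def Z (V : List Bool) : ℝ := ∑ p ∈ NCSeries.splits V, topLim p.1 * botLim p.2 (1 / 2)

/-- The rate function `ρ_n(ε,b) = (|log ε|+2)ⁿ ε + (|log(1-b)|+2)ⁿ (1-b)`. [folklore] -/
def rate (n : ℕ) (ε b : ℝ) : ℝ :=
  (|Real.log ε| + 2) ^ n * ε + (|Real.log (1 - b)| + 2) ^ n * (1 - b)

/-- `ρ_n ≥ 0`. [folklore] -/
theorem rate_nonneg (n : ℕ) {ε b : ℝ} (hε : 0 ≤ ε) (hb : b ≤ 1) : 0 ≤ rate n ε b := by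
  unfold rate
  have : 0 ≤ 1 - b := by linarith
  positivity

/-- `ρ_n` increases with `n`. [folklore] -/
theorem rate_mono (n m : ℕ) (hnm : n ≤ m) {ε b : ℝ} (hε : 0 ≤ ε) (hb : b ≤ 1) :
    rate n ε b ≤ rate m ε b := by
  unfold rate
  have : 0 ≤ 1 - b := by linarith
  gcongr
  · linarith [abs_nonneg (Real.log ε)]
  · linarith [abs_nonneg (Real.log (1 - b))]

/-- `|ac - AC| ≤ (A-a)M + M(C-c)` for `0 ≤ a ≤ A ≤ M`, `0 ≤ c ≤ C ≤ M`. [folklore] -/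
theorem abs_mul_sub_mul_le {a A c C M : ℝ} (ha0 : 0 ≤ a) (haA : a ≤ A) (hA : A ≤ M) (hc0 : 0 ≤ c)
    (hcC : c ≤ C) (hC : C ≤ M) : |a * c - A * C| ≤ (A - a) * M + M * (C - c) := by
  have h1 : A * C - a * c = (A - a) * C + a * (C - c) := by ring
  rw [abs_sub_comm, abs_of_nonneg (by rw [h1]; nlinarith), h1]
  have hM : 0 ≤ M := ha0.trans (haA.trans hA)
  nlinarith [mul_le_mul_of_nonneg_left hC (sub_nonneg.mpr haA),
    mul_le_mul_of_nonneg_right (haA.trans hA) (sub_nonneg.mpr hcC)]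

/-- `|log(1/2)| ≤ 1`. [folklore] -/
theorem abs_log_half_le : |Real.log (1 / 2 : ℝ)| ≤ 1 := by
  rw [one_div, Real.log_inv, abs_neg, abs_of_pos (Real.log_pos (by norm_num))]
  have := Real.log_two_lt_d9; linarith

/-- **Convergence with rate**: `|I_V(ε,b) - Z(V)| ≤ (|V|+1)² 16^{|V|} ρ_{|V|}(ε,b)` for a convergent
`V`, `0 < ε < 1/2 < b < 1`. [folklore] -/
theorem abs_iterInt_sub_Z_le {V : List Bool} (hV : IsConvWord V) {ε b : ℝ} (hε0 : 0 < ε)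
    (hε : ε < 1 / 2) (hb1 : 1 / 2 < b) (hb : b < 1) :
    |iterInt P V ε b - Z V| ≤ (V.length + 1) ^ 2 * 16 ^ V.length * rate V.length ε b := by
  classical
  have hhalf : (1 / 2 : ℝ) ∈ Ioo (0 : ℝ) 1 := ⟨by norm_num, by norm_num⟩
  have hεlt : ε < 1 := by linarith
  have h1b : 0 ≤ 1 - b := by linarith
  rw [iterInt_chen isOpen_Ioo01 ordConnected_Ioo01 continuousOn_P (a := ε) (b := 1 / 2) ⟨hε0, hεlt⟩
    hhalf V (c := b) ⟨by linarith, hb⟩, Z, ← Finset.sum_sub_distrib]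
  have hcard : (NCSeries.splits V).card = V.length + 1 := by
    rw [NCSeries.splits, Finset.card_map]; simp
  -- termwise estimate
  have key : ∀ p ∈ NCSeries.splits V,
      |iterInt P p.1 (1 / 2) b * iterInt P p.2 ε (1 / 2) - topLim p.1 * botLim p.2 (1 / 2)| ≤
        (V.length + 1) * 16 ^ V.length * rate V.length ε b := by
    intro p hp
    rw [NCSeries.mem_splits] at hp
    have ht : IsTopWord p.1 := hV.1.prefix p.1 p.2 hp
    have hbw : IsBotWord p.2 := hV.2.suffix p.1 p.2 hp
    have hlen1 : p.1.length ≤ V.length := by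
      have := congrArg List.length hp; simp at this; omega
    have hlen2 : p.2.length ≤ V.length := by
      have := congrArg List.length hp; simp at this; omega
    have ha0 : 0 ≤ iterInt P p.1 (1 / 2) b := iterInt_P_nonneg _ (by norm_num) hb1.le hb
    have haA : iterInt P p.1 (1 / 2) b ≤ topLim p.1 := iterInt_le_topLim ht ⟨hb1, hb⟩
    have hA : topLim p.1 ≤ 4 ^ V.length :=
      (topLim_le ht).trans (pow_le_pow_right₀ (by norm_num) hlen1)
    have hc0 : 0 ≤ iterInt P p.2 ε (1 / 2) := iterInt_P_nonneg _ hε0 hε.le (by norm_num)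
    have hcC : iterInt P p.2 ε (1 / 2) ≤ botLim p.2 (1 / 2) := iterInt_le_botLim hbw hhalf ⟨hε0, hε⟩
    have hC : botLim p.2 (1 / 2) ≤ 4 ^ V.length := (botLim_le hbw hhalf).trans (by
      norm_num; exact pow_le_pow_right₀ (by norm_num) hlen2)
    have hAa : topLim p.1 - iterInt P p.1 (1 / 2) b ≤
        (V.length + 1) * (4 ^ V.length * (|Real.log (1 - b)| + 2) ^ V.length * (1 - b)) := by
      refine (topLim_sub_le ht hb1 hb).trans ?_
      have hp1 : (p.1.length : ℝ) + 1 ≤ V.length + 1 := by exact_mod_cast Nat.succ_le_succ hlen1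
      gcongr
      · norm_num
      · linarith [abs_nonneg (Real.log (1 - b))]
    have hCc : botLim p.2 (1 / 2) - iterInt P p.2 ε (1 / 2) ≤
        (V.length + 1) * ((|Real.log ε| + 2) ^ V.length * 4 ^ V.length * ε) := by
      refine (botLim_sub_le hbw hε0 hε.le hε (by norm_num)).trans ?_
      have hlog : |Real.log (1 - 1 / 2 : ℝ)| ≤ 1 := by norm_num; exact abs_log_half_le
      have hp2 : (p.2.length : ℝ) + 1 ≤ V.length + 1 := by exact_mod_cast Nat.succ_le_succ hlen2
      have hbase : |Real.log ε| + |Real.log (1 - 1 / 2)| + 1 ≤ |Real.log ε| + 2 := by linarith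
      calc (p.2.length + 1 : ℝ) *
            ((|Real.log ε| + |Real.log (1 - 1 / 2)| + 1) ^ p.2.length * 4 ^ p.2.length * ε)
          ≤ (V.length + 1) * ((|Real.log ε| + 2) ^ p.2.length * 4 ^ p.2.length * ε) :=
            mul_le_mul hp2 (mul_le_mul_of_nonneg_right (mul_le_mul_of_nonneg_right
              (pow_le_pow_left₀ (by positivity) hbase _) (by positivity)) hε0.le) (by positivity)
              (by positivity)
        _ ≤ (V.length + 1) * ((|Real.log ε| + 2) ^ V.length * 4 ^ V.length * ε) := by
            gcongr
            · linarith [abs_nonneg (Real.log ε)]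
            · norm_num
    refine (abs_mul_sub_mul_le ha0 haA hA hc0 hcC hC).trans ?_
    have h16 : (16 : ℝ) ^ V.length = 4 ^ V.length * 4 ^ V.length := by rw [← mul_pow]; norm_num
    have h4 : (0 : ℝ) ≤ 4 ^ V.length := by positivity
    calc (topLim p.1 - iterInt P p.1 (1 / 2) b) * 4 ^ V.length +
          4 ^ V.length * (botLim p.2 (1 / 2) - iterInt P p.2 ε (1 / 2))
        ≤ (V.length + 1) * (4 ^ V.length * (|Real.log (1 - b)| + 2) ^ V.length * (1 - b)) *
            4 ^ V.length +
          4 ^ V.length * ((V.length + 1) * ((|Real.log ε| + 2) ^ V.length * 4 ^ V.length * ε)) :=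
          add_le_add (mul_le_mul_of_nonneg_right hAa h4) (mul_le_mul_of_nonneg_left hCc h4)
      _ = (V.length + 1) * 16 ^ V.length * rate V.length ε b := by
          rw [h16, rate]; ring
  refine (Finset.abs_sum_le_sum_abs _ _).trans ((Finset.sum_le_card_nsmul _ _ _ key).trans ?_)
  rw [hcard, nsmul_eq_mul]
  push_cast
  exact le_of_eq (by ring)

end Conv

/-! ## 7. The bridge to the tree's simplex integrals: `L_w(b) = Λ_w(b)` -/

section Bridge

/-- The nested integral of `e :: w` as a lower Lebesgue integral over `(0,b)` with an indicator.
[folklore] -/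
theorem ofReal_iterInt_cons_eq_lintegral (e : Bool) (w : List Bool) {ε b : ℝ} (hε : 0 < ε)
    (hεb : ε < b) (hb : b < 1) :
    ENNReal.ofReal (iterInt P (e :: w) ε b) =
      ∫⁻ t in Ioo 0 b, (Ioc ε b).indicator (fun t => ENNReal.ofReal (P e t * iterInt P w ε t)) t := by
  have hcont : ContinuousOn (fun t => P e t * iterInt P w ε t) (Icc ε b) :=
    (continuousOn_mul_iterInt isOpen_Ioo01 ordConnected_Ioo01 continuousOn_P ⟨hε, hεb.trans hb⟩ e w).mono
      (Icc_subset_Ioo hε hb)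
  rw [iterInt_cons, intervalIntegral.integral_of_le hεb.le,
    ofReal_integral_eq_lintegral_ofReal (hcont.integrableOn_Icc.mono_set Ioc_subset_Icc_self)
      (ae_restrict_of_forall_mem measurableSet_Ioc fun t ht => mul_nonneg
        (P_nonneg e t ⟨hε.trans ht.1, ht.2.trans_lt hb⟩)
        (iterInt_P_nonneg w hε ht.1.le (ht.2.trans_lt hb))),
    lintegral_indicator measurableSet_Ioc, Measure.restrict_restrict measurableSet_Ioc]
  have hset : Ioc ε b ∩ Ioo 0 b = Ioo ε b := by
    ext t; simp only [mem_inter_iff, mem_Ioc, mem_Ioo]; constructor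
    · rintro ⟨⟨h1, _⟩, _, h3⟩; exact ⟨h1, h3⟩
    · rintro ⟨h1, h2⟩; exact ⟨⟨h1, h2.le⟩, hε.trans h1, h2⟩
  rw [hset, Measure.restrict_congr_set Ioo_ae_eq_Ioc]

/-- **The regularised nested integrals are the tree's simplex integrals**: `L_w(b) = Λ_w(b)` for a
bottom word and `b ∈ (0,1)`; monotone convergence along `ε_k = b/(k+2)`, by induction on the word
through `KZ.MZVSimplex.wordLIntegral_cons`. [cite: KontsevichZagier2001, §1.1] -/
theorem ofReal_botLim_eq_Λ : ∀ (w : List Bool), IsBotWord w → ∀ {b : ℝ}, b ∈ Ioo (0 : ℝ) 1 →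
    ENNReal.ofReal (botLim w b) = Λ w b
  | [], _, b, hb => by rw [botLim_nil hb, Λ_nil, ENNReal.ofReal_one]
  | e :: w, hw, b, hb => by
    have hw' : IsBotWord w := hw.suffix [e] w rfl
    have hpos : ∀ c, ∀ t ∈ Ioo (0 : ℝ) 1, 0 ≤ P c t := fun c t ht => P_nonneg c t ht
    -- the sequence ε_k = b/(k+2)
    set εs : ℕ → ℝ := fun k => b / (k + 2) with hεs
    have hεpos : ∀ k, 0 < εs k := fun k => by
      show 0 < b / (k + 2); exact div_pos hb.1 (by positivity)
    have hεlt : ∀ k, εs k < b := fun k => by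
      show b / (k + 2) < b
      rw [div_lt_iff₀ (by positivity)]; nlinarith [hb.1]
    have hεanti : Antitone εs := fun k l hkl => by
      show b / (l + 2) ≤ b / (k + 2)
      exact div_le_div_of_nonneg_left hb.1.le (by positivity) (by exact_mod_cast Nat.add_le_add_right hkl 2)
    have hεtend0 : Tendsto εs atTop (𝓝 0) := by
      have h1 : Tendsto (fun k : ℕ => (k : ℝ) + 2) atTop atTop :=
        tendsto_atTop_add_const_right _ _ tendsto_natCast_atTop_atTop
      exact tendsto_const_nhds.div_atTop h1
    have hεtend : Tendsto εs atTop (𝓝[>] 0) :=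
      tendsto_nhdsWithin_iff.mpr ⟨hεtend0, Eventually.of_forall fun k => hεpos k⟩
    have hεmem : ∀ k, εs k ∈ Ioo (0 : ℝ) 1 := fun k => ⟨hεpos k, (hεlt k).trans hb.2⟩
    -- the approximating functions
    set G : ℕ → ℝ → ℝ≥0∞ := fun k t =>
      (Ioc (εs k) b).indicator (fun t => ENNReal.ofReal (P e t * iterInt P w (εs k) t)) t with hG
    have hfcont : ∀ k, ContinuousOn (fun t => P e t * iterInt P w (εs k) t) (Ioo 0 1) := fun k =>
      continuousOn_mul_iterInt isOpen_Ioo01 ordConnected_Ioo01 continuousOn_P (hεmem k) e w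
    have hGmeas : ∀ k, AEMeasurable (G k) (volume.restrict (Ioo 0 b)) := fun k =>
      (ENNReal.measurable_ofReal.comp_aemeasurable
        (((hfcont k).mono (Ioo_subset_Ioo_right hb.2.le)).aemeasurable measurableSet_Ioo)).indicator
        measurableSet_Ioc
    have hGmono : ∀ t ∈ Ioo 0 b, Monotone fun k => G k t := by
      intro t ht k l hkl
      show (Ioc (εs k) b).indicator (fun t => ENNReal.ofReal (P e t * iterInt P w (εs k) t)) t ≤
        (Ioc (εs l) b).indicator (fun t => ENNReal.ofReal (P e t * iterInt P w (εs l) t)) t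
      by_cases hk : t ∈ Ioc (εs k) b
      · have hl : t ∈ Ioc (εs l) b := ⟨(hεanti hkl).trans_lt hk.1, hk.2⟩
        rw [indicator_of_mem hk, indicator_of_mem hl]
        refine ENNReal.ofReal_le_ofReal (mul_le_mul_of_nonneg_left ?_
          (P_nonneg e t ⟨ht.1, ht.2.trans hb.2⟩))
        exact iterInt_anti_left isOpen_Ioo01 ordConnected_Ioo01 continuousOn_P hpos (hεmem l) (hεmem k)
          ⟨ht.1, ht.2.trans hb.2⟩ (hεanti hkl) hk.1.le w
      · rw [indicator_of_notMem hk]; exact bot_le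
    -- pointwise limit
    have hGlim : ∀ t ∈ Ioo 0 b,
        Tendsto (fun k => G k t) atTop (𝓝 (ENNReal.ofReal (P e t) * Λ w t)) := by
      intro t ht
      have ht1 : t ∈ Ioo (0 : ℝ) 1 := ⟨ht.1, ht.2.trans hb.2⟩
      have hev : ∀ᶠ k in atTop, εs k < t := hεtend0.eventually (gt_mem_nhds ht.1)
      have h2 : Tendsto (fun k => ENNReal.ofReal (P e t) * ENNReal.ofReal (iterInt P w (εs k) t)) atTop
          (𝓝 (ENNReal.ofReal (P e t) * Λ w t)) := by
        rw [← ofReal_botLim_eq_Λ w hw' ht1]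
        exact ENNReal.Tendsto.const_mul ((ENNReal.continuous_ofReal.tendsto _).comp
          ((tendsto_botLim hw' ht1).comp hεtend)) (Or.inr ENNReal.ofReal_ne_top)
      refine h2.congr' ?_
      filter_upwards [hev] with k hk
      show _ = (Ioc (εs k) b).indicator (fun t => ENNReal.ofReal (P e t * iterInt P w (εs k) t)) t
      rw [indicator_of_mem (show t ∈ Ioc (εs k) b from ⟨hk, ht.2.le⟩), ENNReal.ofReal_mul (P_nonneg e t ht1)]
    have hGsup : ∀ t ∈ Ioo 0 b, (⨆ k, G k t) = ENNReal.ofReal (P e t) * Λ w t := fun t ht =>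
      tendsto_nhds_unique (tendsto_atTop_iSup (hGmono t ht)) (hGlim t ht)
    -- monotone convergence
    have hMCT : ∫⁻ t in Ioo 0 b, ⨆ k, G k t = ⨆ k, ∫⁻ t in Ioo 0 b, G k t :=
      lintegral_iSup' hGmeas (ae_restrict_of_forall_mem measurableSet_Ioo hGmono)
    have hL : ∫⁻ t in Ioo 0 b, ⨆ k, G k t = Λ (e :: w) b := by
      rw [Λ_cons]
      exact setLIntegral_congr_fun measurableSet_Ioo fun t ht => hGsup t ht
    have hR : ∀ k, ∫⁻ t in Ioo 0 b, G k t = ENNReal.ofReal (iterInt P (e :: w) (εs k) b) := fun k =>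
      (ofReal_iterInt_cons_eq_lintegral e w (hεpos k) (hεlt k) hb.2).symm
    have hmono2 : Monotone fun k => ENNReal.ofReal (iterInt P (e :: w) (εs k) b) := fun k l hkl =>
      ENNReal.ofReal_le_ofReal (iterInt_anti_left isOpen_Ioo01 ordConnected_Ioo01 continuousOn_P hpos
        (hεmem l) (hεmem k) hb (hεanti hkl) (hεlt k).le (e :: w))
    have hlim2 : Tendsto (fun k => ENNReal.ofReal (iterInt P (e :: w) (εs k) b)) atTop
        (𝓝 (ENNReal.ofReal (botLim (e :: w) b))) :=
      (ENNReal.continuous_ofReal.tendsto _).comp ((tendsto_botLim hw hb).comp hεtend)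
    have hsup2 : (⨆ k, ENNReal.ofReal (iterInt P (e :: w) (εs k) b)) = ENNReal.ofReal (botLim (e :: w) b) :=
      tendsto_nhds_unique (tendsto_atTop_iSup hmono2) hlim2
    calc ENNReal.ofReal (botLim (e :: w) b)
        = ⨆ k, ENNReal.ofReal (iterInt P (e :: w) (εs k) b) := hsup2.symm
      _ = ⨆ k, ∫⁻ t in Ioo 0 b, G k t := by simp_rw [hR]
      _ = ∫⁻ t in Ioo 0 b, ⨆ k, G k t := hMCT.symm
      _ = Λ (e :: w) b := hL

/-- Finiteness of the tree's simplex integrals below `1` for bottom words. [folklore] -/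
theorem Λ_lt_top {w : List Bool} (hw : IsBotWord w) {b : ℝ} (hb : b ∈ Ioo (0 : ℝ) 1) : Λ w b < ∞ := by
  rw [← ofReal_botLim_eq_Λ w hw hb]; exact ENNReal.ofReal_lt_top

/-- `L_w(b) = Λ_w(b)` in `ℝ`. [folklore] -/
theorem botLim_eq_toReal_Λ {w : List Bool} (hw : IsBotWord w) {b : ℝ} (hb : b ∈ Ioo (0 : ℝ) 1) :
    botLim w b = (Λ w b).toReal := by
  rw [← ofReal_botLim_eq_Λ w hw hb, ENNReal.toReal_ofReal (botLim_nonneg hw hb)]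

end Bridge

/-! ## 8. Identification of `Z(V)` with the multiple zeta value -/

section Zeta

/-- For a convergent word and `b ∈ (1/2,1)`: `L_V(b) = Σ_{V=V₁V₂} I_{V₁}(1/2,b) L_{V₂}(1/2)`.
[folklore] -/
theorem botLim_eq_sum_splits {V : List Bool} (hV : IsConvWord V) {b : ℝ} (hb : b ∈ Ioo (1 / 2 : ℝ) 1) :
    botLim V b = ∑ p ∈ NCSeries.splits V, iterInt P p.1 (1 / 2) b * botLim p.2 (1 / 2) := by
  have hb' : b ∈ Ioo (0 : ℝ) 1 := ⟨by linarith [hb.1], hb.2⟩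
  have hhalf : (1 / 2 : ℝ) ∈ Ioo (0 : ℝ) 1 := ⟨by norm_num, by norm_num⟩
  refine tendsto_nhds_unique (tendsto_botLim hV.2 hb') ?_
  have hlim : Tendsto (fun ε => ∑ p ∈ NCSeries.splits V, iterInt P p.1 (1 / 2) b * iterInt P p.2 ε (1 / 2))
      (𝓝[>] 0) (𝓝 (∑ p ∈ NCSeries.splits V, iterInt P p.1 (1 / 2) b * botLim p.2 (1 / 2))) := by
    refine tendsto_finsetSum _ fun p hp => Tendsto.const_mul _ (tendsto_botLim ?_ hhalf)
    exact hV.2.suffix p.1 p.2 (NCSeries.mem_splits.mp hp)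
  refine hlim.congr' ?_
  filter_upwards [Ioo_mem_nhdsGT (by norm_num : (0 : ℝ) < 1 / 2)] with ε hε
  exact (iterInt_chen isOpen_Ioo01 ordConnected_Ioo01 continuousOn_P (a := ε) (b := 1 / 2)
    ⟨hε.1, by linarith [hε.2]⟩ hhalf V hb').symm

/-- `L_V(b) → Z(V)` as `b → 1⁻` for a convergent word. [folklore] -/
theorem tendsto_botLim_Z {V : List Bool} (hV : IsConvWord V) :
    Tendsto (fun b => botLim V b) (𝓝[<] 1) (𝓝 (Z V)) := by
  have hlim : Tendsto (fun b => ∑ p ∈ NCSeries.splits V, iterInt P p.1 (1 / 2) b * botLim p.2 (1 / 2))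
      (𝓝[<] 1) (𝓝 (Z V)) := by
    refine tendsto_finsetSum _ fun p hp => Tendsto.mul_const _ (tendsto_topLim ?_)
    exact hV.1.prefix p.1 p.2 (NCSeries.mem_splits.mp hp)
  refine hlim.congr' ?_
  filter_upwards [Ioo_mem_nhdsLT (by norm_num : (1 / 2 : ℝ) < 1)] with b hb
  exact (botLim_eq_sum_splits hV hb).symm

/-- `Λ_V(1 - 1/(k+2)) → Λ_V(1)` (monotone convergence on the increasing simplices). [folklore] -/
theorem tendsto_Λ_one (V : List Bool) :
    Tendsto (fun k : ℕ => Λ V (1 - 1 / ((k : ℝ) + 2))) atTop (𝓝 (Λ V 1)) := by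
  set bs : ℕ → ℝ := fun k => 1 - 1 / ((k : ℝ) + 2) with hbs
  set S : ℝ → Set (Fin V.length → ℝ) := fun x =>
    {t | (∀ i, 0 < t i) ∧ (∀ i, t i < x) ∧ StrictAnti t} with hS
  set F : (Fin V.length → ℝ) → ℝ≥0∞ := fun t =>
    ∏ i : Fin V.length, ENNReal.ofReal (KZ.mzvForm (V.getD i false) (t i)) with hF
  have hFm : Measurable F := KZ.MZVSimplex.measurable_wordIntegrand V V.length
  have hSm : ∀ x, MeasurableSet (S x) := fun x => KZ.MZVSimplex.measurableSet_simplexLT V.length x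
  have hbmono : Monotone bs := fun k l hkl => by
    show 1 - 1 / ((k : ℝ) + 2) ≤ 1 - 1 / ((l : ℝ) + 2)
    have : (1 : ℝ) / (l + 2) ≤ 1 / (k + 2) :=
      div_le_div_of_nonneg_left zero_le_one (by positivity) (by exact_mod_cast Nat.add_le_add_right hkl 2)
    linarith
  have hbtend : Tendsto bs atTop (𝓝 1) := by
    have h1 : Tendsto (fun k : ℕ => (k : ℝ) + 2) atTop atTop :=
      tendsto_atTop_add_const_right _ _ tendsto_natCast_atTop_atTop
    have h2 : Tendsto (fun k : ℕ => (1 : ℝ) / ((k : ℝ) + 2)) atTop (𝓝 0) := tendsto_const_nhds.div_atTop h1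
    have h3 := (tendsto_const_nhds (x := (1 : ℝ))).sub h2
    rw [sub_zero] at h3
    exact h3
  change Tendsto (fun k => ∫⁻ t in S (bs k), F t) atTop (𝓝 (∫⁻ t in S 1, F t))
  have hind : ∀ k, ∫⁻ t in S (bs k), F t = ∫⁻ t, (S (bs k)).indicator F t := fun k =>
    (lintegral_indicator (hSm _) F).symm
  simp_rw [hind, ← lintegral_indicator (hSm 1) F]
  refine lintegral_tendsto_of_tendsto_of_monotone (fun k => (hFm.indicator (hSm _)).aemeasurable)
    (ae_of_all _ fun t k l hkl => ?_) (ae_of_all _ fun t => ?_)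
  · exact indicator_le_indicator_of_subset (KZ.MZVSimplex.simplexLT_mono V.length (hbmono hkl))
      (fun _ => bot_le) t
  · by_cases ht : t ∈ S 1
    · have hev : ∀ᶠ k in atTop, t ∈ S (bs k) := by
        have : ∀ i, ∀ᶠ k in atTop, t i < bs k := fun i => hbtend.eventually (lt_mem_nhds (ht.2.1 i))
        filter_upwards [Filter.eventually_all.mpr this] with k hk
        exact ⟨ht.1, hk, ht.2.2⟩
      rw [indicator_of_mem ht]
      refine (tendsto_const_nhds (x := F t)).congr' ?_
      filter_upwards [hev] with k hk; rw [indicator_of_mem hk]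
    · have h0 : ∀ k, (S (bs k)).indicator F t = 0 := fun k =>
        indicator_of_notMem (fun h => ht (KZ.MZVSimplex.simplexLT_mono V.length (by
          show 1 - 1 / ((k : ℝ) + 2) ≤ 1
          have : (0 : ℝ) ≤ 1 / (k + 2) := by positivity
          linarith) h)) F
      simp_rw [h0, indicator_of_notMem ht]
      exact tendsto_const_nhds


/-- **`Z(V) = ζ(V)`**: the regularised iterated integral of a convergent word is Kontsevich's
multiple zeta value `multipleZeta (ofBinaryWord V)`. [cite: KontsevichZagier2001, §1.1] -/
theorem Z_eq_multipleZeta {V : List Bool} (hV : IsConvWord V) :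
    Z V = multipleZeta (MZV.ofBinaryWord V) := by
  set bs : ℕ → ℝ := fun k => 1 - 1 / ((k : ℝ) + 2) with hbs
  have hbmem : ∀ k, bs k ∈ Ioo (0 : ℝ) 1 := fun k => by
    constructor
    · show 0 < 1 - 1 / ((k : ℝ) + 2)
      rw [sub_pos, div_lt_one (by positivity)]; linarith [(k.cast_nonneg : (0 : ℝ) ≤ k)]
    · show 1 - 1 / ((k : ℝ) + 2) < 1
      have : (0 : ℝ) < 1 / (k + 2) := by positivity
      linarith
  have hbtend : Tendsto bs atTop (𝓝[<] 1) := by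
    refine tendsto_nhdsWithin_iff.mpr ⟨?_, Eventually.of_forall fun k => (hbmem k).2⟩
    have h1 : Tendsto (fun k : ℕ => (k : ℝ) + 2) atTop atTop :=
      tendsto_atTop_add_const_right _ _ tendsto_natCast_atTop_atTop
    have h2 : Tendsto (fun k : ℕ => (1 : ℝ) / ((k : ℝ) + 2)) atTop (𝓝 0) := tendsto_const_nhds.div_atTop h1
    have h3 := (tendsto_const_nhds (x := (1 : ℝ))).sub h2
    rw [sub_zero] at h3
    exact h3
  have h1 : Tendsto (fun k => botLim V (bs k)) atTop (𝓝 (Z V)) := (tendsto_botLim_Z hV).comp hbtend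
  have hΛ1 : Λ V 1 = ENNReal.ofReal (multipleZeta (MZV.ofBinaryWord V)) := by
    refine Λ_one_eq ?_ hV.2
    rcases hV.1 with h | h
    · simp [h]
    · rw [h]; simp
  have h2 : Tendsto (fun k => botLim V (bs k)) atTop (𝓝 (multipleZeta (MZV.ofBinaryWord V))) := by
    have ht : Tendsto (fun k => (Λ V (bs k)).toReal) atTop
        (𝓝 (ENNReal.ofReal (multipleZeta (MZV.ofBinaryWord V))).toReal) := by
      rw [← hΛ1]
      exact (ENNReal.tendsto_toReal (by rw [hΛ1]; exact ENNReal.ofReal_ne_top)).comp (tendsto_Λ_one V)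
    rw [ENNReal.toReal_ofReal (multipleZeta_nonneg _)] at ht
    exact ht.congr fun k => (botLim_eq_toReal_Λ hV.2 (hbmem k)).symm
  exact tendsto_nhds_unique h1 h2

/-- `Z(∅) = 1`. [folklore] -/
@[simp] theorem Z_nil : Z [] = 1 := by
  have h : botLim [] (1 / 2) = 1 := botLim_nil (by norm_num)
  simp only [Z, NCSeries.splits, List.length_nil, Finset.sum_map, Function.Embedding.coeFn_mk,
    List.take_nil, List.drop_nil, topLim_nil, h, mul_one]
  simp

/-- **The improper iterated integral with rate**: `|I_V(ε,b) - ζ(V)| ≤ (|V|+1)² 16^{|V|}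
ρ_{|V|}(ε,b)` for a convergent word and `0 < ε < 1/2 < b < 1`. [cite: Furusho2003, §3.2] -/
theorem abs_iterInt_sub_multipleZeta_le {V : List Bool} (hV : IsConvWord V) {ε b : ℝ}
    (hε0 : 0 < ε) (hε : ε < 1 / 2) (hb1 : 1 / 2 < b) (hb : b < 1) :
    |iterInt P V ε b - multipleZeta (MZV.ofBinaryWord V)| ≤
      (V.length + 1) ^ 2 * 16 ^ V.length * rate V.length ε b := by
  rw [← Z_eq_multipleZeta hV]
  exact abs_iterInt_sub_Z_le hV hε0 hε hb1 hb

end Zeta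

/-! ## 9. The signed KZ densities `A ↦ dt/t`, `B ↦ dt/(t-1)` and their transport series -/

section Signed

/-- Rescaling each letter's density by a constant rescales the iterated integral by the product of
the constants along the word. [folklore] -/
theorem iterInt_smul_densities {α : Type*} (σ : α → ℝ) (f : α → ℝ → ℝ) (a : ℝ) :
    ∀ (w : List α) (b : ℝ), iterInt (fun c t => σ c * f c t) w a b = (w.map σ).prod * iterInt f w a b
  | [], b => by simp
  | c :: w, b => by
    rw [iterInt_cons, iterInt_cons, List.map_cons, List.prod_cons, mul_assoc,
      ← intervalIntegral.integral_const_mul, ← intervalIntegral.integral_const_mul]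
    refine intervalIntegral.integral_congr fun t _ => ?_
    simp only [iterInt_smul_densities σ f a w t]
    ring

/-- The letter densities of `G'(t) = (A/t + B/(t-1)) G(t)`: `A = false ↦ 1/t`, `B = true ↦ 1/(t-1)`.
[cite: Furusho2003, §3.1 (KZ)] -/
def F₀ : Bool → ℝ → ℝ := fun c t => (if c then -1 else 1) * P c t

/-- `F₀ A = 1/t`. [folklore] -/
theorem F₀_false (t : ℝ) : F₀ false t = 1 / t := by simp [F₀]

/-- `F₀ B = 1/(t-1)`. [folklore] -/
theorem F₀_true (t : ℝ) : F₀ true t = 1 / (t - 1) := by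
  simp only [F₀, if_true, P_true]
  rw [← neg_sub, div_neg]; ring

/-- The KZ densities are continuous on `(0,1)`. [folklore] -/
theorem continuousOn_F₀ (c : Bool) : ContinuousOn (F₀ c) (Ioo 0 1) :=
  continuousOn_const.mul (continuousOn_P c)

/-- Signs: `I^{F₀}_w = (-1)^{#B(w)} I^{P}_w` (each `B` carries `dt/(t-1) = -dt/(1-t)`). [cite:
Furusho2003, Prop. 3.2.3 (the sign (-1)^{dp W})] -/
theorem iterInt_F₀ (w : List Bool) (a b : ℝ) :
    iterInt F₀ w a b = (-1) ^ (w.count true) * iterInt P w a b := by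
  rw [show F₀ = fun c t => (if c then (-1 : ℝ) else 1) * P c t from rfl, iterInt_smul_densities]
  congr 1
  induction w with
  | nil => simp
  | cons c w ih => cases c <;> simp [ih, pow_succ]

/-- **The transport series of the KZ equation on `[a,b] ⊆ (0,1)`**: `T̂(a,b) = Σ_w I^{F₀}_w(a,b) w ∈
ℝ⟨⟨A,B⟩⟩`, i.e. `G_a(b)` for the solution `G_a` with `G_a(a) = 1`. [cite: Furusho2003, §3.1] -/
def kzTransport (a b : ℝ) : NCSeries Bool ℝ := transportSeries F₀ a b

/-- Coefficients of the KZ transport series are signed positive iterated integrals. [folklore] -/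
theorem kzTransport_apply (a b : ℝ) (w : List Bool) :
    kzTransport a b w = (-1) ^ (w.count true) * iterInt P w a b := iterInt_F₀ w a b

/-- The KZ transport series is group-like. [folklore] -/
theorem isGroupLike_kzTransport {a b : ℝ} (ha : a ∈ Ioo (0 : ℝ) 1) (hb : b ∈ Ioo (0 : ℝ) 1) :
    NCSeries.IsGroupLike (kzTransport a b) :=
  isGroupLike_transportSeries isOpen_Ioo01 ordConnected_Ioo01 continuousOn_F₀ ha hb

/-- `T̂(a,b)_A = log(b/a)`. [folklore] -/
theorem kzTransport_A {a b : ℝ} (ha : 0 < a) (hb : 0 < b) :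
    kzTransport a b [false] = Real.log (b / a) := by
  rw [kzTransport, transportSeries_apply, iterInt_cons]
  simp only [iterInt_nil, mul_one, F₀_false]
  rw [show (fun t : ℝ => 1 / t) = fun t => t⁻¹ from funext fun t => one_div t, integral_inv_of_pos ha hb]

/-- `T̂(a,b)_B = log((1-b)/(1-a))`. [folklore] -/
theorem kzTransport_B {a b : ℝ} (ha : a < 1) (hb : b < 1) :
    kzTransport a b [true] = Real.log ((1 - b) / (1 - a)) := by
  rw [kzTransport, transportSeries_apply, iterInt_cons]
  simp only [iterInt_nil, mul_one, F₀_true]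
  have h : ∀ t : ℝ, 1 / (t - 1) = -(1 - t)⁻¹ := fun t => by rw [← neg_sub, one_div, inv_neg]
  simp_rw [h]
  rw [intervalIntegral.integral_neg, intervalIntegral.integral_comp_sub_left (fun t => t⁻¹) 1,
    integral_inv_of_pos (by linarith) (by linarith), ← Real.log_inv, inv_div]

end Signed

end KZ3
end Literature.NumberTheory.Transcendental
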